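import Summits.BirchSwinnertonDyer.BirchSwinnertonDyer.Theorems.ResidualThetaTransportAtTwoSignedMuSeedAtTwoPlusTowerStaircase
import Summits.BirchSwinnertonDyer.BirchSwinnertonDyer.Theorems.ResidualThetaTransportAtTwoLambdaLeCardQuotient
import Summits.BirchSwinnertonDyer.Rank1Residual.Additive.CongruentPartnerBudgetSchemaHolds
import Literature.NumberTheory.EllipticCurves.Kobayashi2003.SignedSelmer
import HarnessLib

/-!
# The TOWER STAIRCASE (part 2, READING): three-term log-concavity, freezing from ONE slack block, the `λ`-reading
# `p^{λ(X)} ≤ #(X/(p,T^{m+k})X)`, and the layer forms `L (n+2) · L n ^ p ≤ L (n+1) ^ (p+1)` / stationarity — for the layer counts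
# of ANY finitely generated `Λ = ℤ_p⟦T⟧`-module (crux Kμ⁺ `SignedMuVanishingAtTwoPlus` stmt-BirchSwinnertonDyer-20689, seed
# `SignedMuSeedAtTwoPlus` stmt-21438, route `ResidualThetaTransportAtTwo`)

Cell `bsd-wall`, width seat `bsd-wall-rtt-p4-w2` (g12). THEOREMS ONLY (no `def`, no named fact, no `sorry`); pure commutative
algebra over `Λ = ℤ_p⟦T⟧` for EVERY prime `p`; `--supports` the crux as a helper; nothing about any curve is asserted; BSD is not
proved by this. Sequel of `…TowerStaircase` (part 1: the counts `c j = #(X/(p,T^j)X)` are positive, monotone, log-concave,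
`p`-dichotomous, and frozen at `#(X/pX)` by the first stall). With `c` ANY function agreeing with the counts (hypothesis `hc`, so
that consumers instantiate with their own bookkeeping):

* `natCard_layer_pow_mul_pow_le` — **three-term log-concavity** `c a ^ (d−b) · c d ^ (b−a) ≤ c b ^ (d−a)` (`a ≤ b ≤ d`);
  `natCard_layer_le_pow` — `c m ≤ c 1 ^ m = #(X/𝔪X)^m`; `natCard_layer_mul_pow_le` — `c (b+n) · c b ^ n ≤ c (b+1) ^ n · c b`;
  `natCard_layer_eq_of_stall` — a stall is final.
* `finite_modP_and_natCard_eq_of_lt` / `natCard_modP_eq_of_lt` — **FREEZING**: one slack block `c (m+k) < p^k · c m` ⇒ `X/pX` finite and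
  `c i = #(X/pX)` for EVERY `i ≥ m+k` (the tree's gap lemma `TowerGap.finite_modP_of_card_quotient_lt` gave finiteness only);
  `pow_mul_natCard_layer_le_of_infinite` — conversely `X/pX` infinite ⇒ every block is full, `p^k · c m ≤ c (m+k)`.
* `pow_lambdaInvariant_le_of_lt` — **the `λ`-reading off two layer counts**: `c (m+k) < p^k · c m ⇒ p^{λ(X)} ≤ c (m+k)` (through RTT's
  `LambdaLowerBound.pow_lambdaInvariant_le_natCard_quotient`, `p^λ ≤ #(X/pX)`, and `TowerGap.moduleFinite_padicInt_of_finite_modP`);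
  `certificate_of_lt` — torsion, `μ = 0`, `#(X/pX) = c (m+k)`, stationarity and the `λ`-bound in one statement;
  `natCard_layer_eq_pow_lambdaInvariant_of_lt(_of_noFinite)` — **EXACT `λ`**: with `X[p] = 0` (resp. no nonzero finite
  `Λ`-submodule) the frozen value is `p^{λ(X)}`, i.e. two descents with sub-maximal growth give `μ = 0` AND `λ` on the nose.
* LAYERS `L n = c (p^n) = #(X/(p, ω_n)X)` (`natCard_quotient_omega_eq`, from `TowerGap.span_C_p_sup_span_omega_eq_towerIdeal`):
  `natCard_layer_pow_logConcave` — **`L (n+2) · L n ^ p ≤ L (n+1) ^ (p+1)`** (in `𝔽_p`-dimensions `d_{n+2} − d_{n+1} ≤ p (d_{n+1} − d_n)`: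
  the growth per layer at most multiplies by `p`); `finite_modP_and_natCard_layer_eq_of_lt`, `layer_certificate_of_lt` — sub-maximal
  growth between layers `n` and `n+1` (`L (n+1) < p^{p^{n+1} − p^n} · L n`) ⇒ `X` torsion, `μ(X) = 0`, `#(X/pX) = L (n+1)`,
  `L n' = L (n+1)` for all `n' ≥ n+1`, `p^{λ(X)} ≤ L (n+1)`; `signedSelmerDual_layer_certificate_of_lt` — the same in the Kobayashi
  currency (`D.X`, `D.mu`, `D.lambda`) of a signed Selmer dual datum, any `p`, any sign.

Reading for the line (the arithmetic identification `A_n/2A_n ≅ X/(2, ω_n)X` of the census tower is NOT formalised, as before):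
for the undecided census field 406203s1 (`d_0..d_3 = 1,2,4,8`; lead's EPS-CERT-406203s1, kit j311634 pending) `d_4 ≤ 15` would certify
`μ = 0` AND `d_n = d_4` for every `n ≥ 4` AND `λ ≤ d_4`, with no `d_0 = 1` hypothesis; `d_4 = 16` certifies nothing, and `d_5 ≤ 31`
is then the next door (`d_5 − d_4 ≤ 2 (d_4 − d_3) = 16` always). For the cell `bsd-2adic` pinch (`…ByReductionTypeAtTwoTowerLambdaPinch`,
«certificates not formalised»): two generalised `2`-descent counts with sub-maximal growth bound `λ(X)` from ABOVE by `d_{n+1}`.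

References: [Washington1997] §13.2–13.3; [Fukuda1994] Thm. 1; [GreenbergLNM1716] §3, p. 136; [Kobayashi2003] Thm. 1.4 (the invariants
only); [Matsumura1987] §13, Thm. 8.4.
-/

set_option autoImplicit false
set_option linter.dupNamespace false

noncomputable section

open scoped Classical Pointwise

open Literature.NumberTheory.EllipticCurves Summit.BirchSwinnertonDyer.Rank1Residual.X5.TowerGap

namespace Summit.BirchSwinnertonDyer.BirchSwinnertonDyer.Theorems.SignedMuAtTwo.TowerStaircase

/-! ## §4 Consumers: log-concavity, freezing, the `λ`-reading -/

section Consumers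

variable (p : ℕ) [hp : Fact p.Prime] {M : Type*} [AddCommGroup M] [Module (IwasawaAlgebra p) M]
  [Module.Finite (IwasawaAlgebra p) M]

/-- **Three-term log-concavity of the layer counts** `c j = #(X/(p,T^j)X)` of a finitely generated `Λ`-module: for
`a ≤ b ≤ d`, `c a ^ (d−b) · c d ^ (b−a) ≤ c b ^ (d−a)`. (Structure-theorem reading: `log_p c` is the Hilbert–Samuel
staircase `Σ_{i<j} ε_i` with `ε` non-increasing.) [folklore] -/
theorem natCard_layer_pow_mul_pow_le (c : ℕ → ℕ)
    (hc : ∀ j, c j = Nat.card (M ⧸ (towerIdeal p j • ⊤ : Submodule (IwasawaAlgebra p) M)))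
    {a b d : ℕ} (hab : a ≤ b) (hbd : b ≤ d) : c a ^ (d - b) * c d ^ (b - a) ≤ c b ^ (d - a) :=
  pow_mul_pow_le_pow_of_logConcave (fun j => (hc j).symm ▸ natCard_layer_pos p j)
    (fun j => by rw [hc, hc, hc]; exact natCard_layer_logConcave p j) hab hbd

/-- **Generator bound**: `#(X/(p,T^m)X) ≤ #(X/(p,T)X)^m = #(X/𝔪X)^m` for every `m`. [folklore] -/
theorem natCard_layer_le_pow (c : ℕ → ℕ)
    (hc : ∀ j, c j = Nat.card (M ⧸ (towerIdeal p j • ⊤ : Submodule (IwasawaAlgebra p) M))) (m : ℕ) :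
    c m ≤ c 1 ^ m :=
  le_pow_of_logConcave (fun j => (hc j).symm ▸ natCard_layer_pos p j)
    (fun j => by rw [hc, hc, hc]; exact natCard_layer_logConcave p j)
    (by rw [hc]; exact natCard_quotient_towerIdeal_zero p) m

/-- **Forward bound**: `c (b+n) · c b ^ n ≤ c (b+1) ^ n · c b` — after ANY two consecutive counts, the growth per further
step is at most their ratio. [folklore] -/
theorem natCard_layer_mul_pow_le (c : ℕ → ℕ)
    (hc : ∀ j, c j = Nat.card (M ⧸ (towerIdeal p j • ⊤ : Submodule (IwasawaAlgebra p) M))) (b n : ℕ) :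
    c (b + n) * c b ^ n ≤ c (b + 1) ^ n * c b :=
  mul_pow_le_pow_mul_of_logConcave (fun j => (hc j).symm ▸ natCard_layer_pos p j)
    (fun j => by rw [hc, hc, hc]; exact natCard_layer_logConcave p j) b n

/-- **A stall is final** for the layer counts: `c (j+1) = c j ⇒ c i = c j` for all `i ≥ j`. [folklore] -/
theorem natCard_layer_eq_of_stall (c : ℕ → ℕ)
    (hc : ∀ j, c j = Nat.card (M ⧸ (towerIdeal p j • ⊤ : Submodule (IwasawaAlgebra p) M)))
    {j : ℕ} (hstall : c (j + 1) = c j) {i : ℕ} (hij : j ≤ i) : c i = c j := by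
  have h := finite_modP_and_natCard_eq_of_stall p (M := M) (j := j) (by rw [← hc, ← hc]; exact hstall)
  rw [hc, hc, h.2 i hij, h.2 j le_rfl]

/-- **FREEZING from one slack block (the gap lemma, sharpened).** If `c (m+k) < p^k · c m` then the staircase stalls inside
`[m, m+k)`, so `X/pX` is finite and **`c i = #(X/pX)` for every `i ≥ m + k`** — the counts are stationary from `m + k` on, at
the exact order of `X/pX` (the tree's `finite_modP_of_card_quotient_lt` gave finiteness only). [folklore] -/
theorem finite_modP_and_natCard_eq_of_lt (c : ℕ → ℕ)
    (hc : ∀ j, c j = Nat.card (M ⧸ (towerIdeal p j • ⊤ : Submodule (IwasawaAlgebra p) M)))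
    {m k : ℕ} (hlt : c (m + k) < p ^ k * c m) :
    Finite (M ⧸ modPSubmodule p M) ∧ ∀ i, m + k ≤ i → c i = Nat.card (M ⧸ modPSubmodule p M) := by
  have hd : ∀ j, c (j + 1) = c j ∨ p * c j ≤ c (j + 1) := fun j => by
    rw [hc, hc]; exact natCard_layer_succ_eq_or_le p j
  obtain ⟨j, hj, hstall⟩ := exists_stall_of_lt hd hlt
  have h := finite_modP_and_natCard_eq_of_stall p (M := M) (j := m + j) (by rw [← hc, ← hc]; exact hstall)
  exact ⟨h.1, fun i hi => by rw [hc]; exact h.2 i (by omega)⟩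

/-- In particular the certificate count itself IS `#(X/pX)`: `c (m+k) < p^k · c m ⇒ #(X/pX) = c (m+k)`. [folklore] -/
theorem natCard_modP_eq_of_lt (c : ℕ → ℕ)
    (hc : ∀ j, c j = Nat.card (M ⧸ (towerIdeal p j • ⊤ : Submodule (IwasawaAlgebra p) M)))
    {m k : ℕ} (hlt : c (m + k) < p ^ k * c m) : Nat.card (M ⧸ modPSubmodule p M) = c (m + k) :=
  ((finite_modP_and_natCard_eq_of_lt p c hc hlt).2 (m + k) le_rfl).symm

/-- **The converse reading: `X/pX` infinite (`μ > 0` or not torsion) ⇒ EVERY block is full**, `p^k · c m ≤ c (m+k)` for all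
`m, k`. [folklore] -/
theorem pow_mul_natCard_layer_le_of_infinite (c : ℕ → ℕ)
    (hc : ∀ j, c j = Nat.card (M ⧸ (towerIdeal p j • ⊤ : Submodule (IwasawaAlgebra p) M)))
    (hinf : ¬ Finite (M ⧸ modPSubmodule p M)) (m k : ℕ) : p ^ k * c m ≤ c (m + k) := by
  by_contra h
  exact hinf (finite_modP_and_natCard_eq_of_lt p c hc (not_le.mp h)).1

omit [Module.Finite (IwasawaAlgebra p) M] in
/-- The two renderings of `pX`: the `Λ`-submodule `(C p) · X` and the `ℤ_p`-submodule `(p) · X` have the same quotient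
cardinality. [folklore] -/
theorem natCard_quotient_span_p_eq [Module ℤ_[p] M] [IsScalarTower ℤ_[p] (IwasawaAlgebra p) M] :
    Nat.card (M ⧸ (Ideal.span {(p : ℤ_[p])} • (⊤ : Submodule ℤ_[p] M))) = Nat.card (M ⧸ modPSubmodule p M) := by
  rw [natCard_quotient_eq_index, natCard_quotient_eq_index]
  congr 1
  ext x
  change x ∈ (Ideal.span {(p : ℤ_[p])} • (⊤ : Submodule ℤ_[p] M)) ↔ x ∈ modPSubmodule p M
  have h := mem_maximalIdeal_pow_smul_top_iff p (M := M) 1 x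
  rw [pow_one, pow_one, PadicInt.maximalIdeal_eq_span_p] at h
  exact h

/-- **The `λ`-reading off two layer counts**: `c (m+k) < p^k · c m ⇒ p^{λ(X)} ≤ c (m+k)` (`X/pX` is then finite of order
`c (m+k)`, `X` is finitely generated over `ℤ_p`, and `p^{λ(X)} ≤ #(X/pX)` by RTT's `LambdaLowerBound`). So `λ(X) ≤ log_p c (m+k)`
— e.g. `λ ≤ d_{n+1}` in `𝔽_p`-dimensions whenever the growth between layers `n` and `n+1` is sub-maximal. [cite: Washington1997, §13.2] -/
theorem pow_lambdaInvariant_le_of_lt (c : ℕ → ℕ)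
    (hc : ∀ j, c j = Nat.card (M ⧸ (towerIdeal p j • ⊤ : Submodule (IwasawaAlgebra p) M)))
    {m k : ℕ} (hlt : c (m + k) < p ^ k * c m) : p ^ lambdaInvariant p M ≤ c (m + k) := by
  letI : Module ℤ_[p] M := Module.compHom M (algebraMap ℤ_[p] (IwasawaAlgebra p))
  haveI : IsScalarTower ℤ_[p] (IwasawaAlgebra p) M := IsScalarTower.of_compHom ℤ_[p] _ M
  have h := finite_modP_and_natCard_eq_of_lt p c hc hlt
  haveI : Module.Finite ℤ_[p] M := moduleFinite_padicInt_of_finite_modP p h.1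
  calc p ^ lambdaInvariant p M ≤ Nat.card (M ⧸ (Ideal.span {(p : ℤ_[p])} • (⊤ : Submodule ℤ_[p] M))) :=
        LambdaLowerBound.pow_lambdaInvariant_le_natCard_quotient p M
    _ = Nat.card (M ⧸ modPSubmodule p M) := natCard_quotient_span_p_eq p
    _ = c (m + k) := (h.2 (m + k) le_rfl).symm

/-- **ONE slack block settles everything the counts can say**: `X` is `Λ`-torsion with `μ(X) = 0`, `X/pX` is finite of order
`c (m+k)`, the counts are stationary from `m+k` on, and `p^{λ(X)} ≤ c (m+k)`. [cite: Washington1997, §13.2] -/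
theorem certificate_of_lt (c : ℕ → ℕ)
    (hc : ∀ j, c j = Nat.card (M ⧸ (towerIdeal p j • ⊤ : Submodule (IwasawaAlgebra p) M)))
    {m k : ℕ} (hlt : c (m + k) < p ^ k * c m) :
    (Module.IsTorsion (IwasawaAlgebra p) M ∧ muInvariant p M = 0) ∧
      Nat.card (M ⧸ modPSubmodule p M) = c (m + k) ∧
      (∀ i, m + k ≤ i → c i = c (m + k)) ∧ p ^ lambdaInvariant p M ≤ c (m + k) := by
  have h := finite_modP_and_natCard_eq_of_lt p c hc hlt
  refine ⟨isTorsion_and_mu_eq_zero_of_finite_modP p h.1, (h.2 (m + k) le_rfl).symm, fun i hi => ?_,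
    pow_lambdaInvariant_le_of_lt p c hc hlt⟩
  rw [h.2 i hi, h.2 (m + k) le_rfl]

/-- **EXACT `λ` from two layer counts when `X` has no `p`-torsion.** After a slack block the frozen value IS `p^{λ(X)}`:
`c (m+k) < p^k · c m` and `X[p] = 0` ⇒ `c i = p^{λ(X)}` for every `i ≥ m+k` (`X` is then `ℤ_p`-free of rank `λ(X)`; RTT's
`SignedTransportAtTwo.natCard_quotient_eq_pow_lambdaInvariant`). In general the frozen value exceeds `p^{λ(X)}` by exactly the
factor `#X[p]` (RTT's `LambdaLowerBound.natCard_quotient_eq_pow_lambdaInvariant_mul_natCard_ker`). [cite: Washington1997, §13.2] -/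
theorem natCard_layer_eq_pow_lambdaInvariant_of_lt (c : ℕ → ℕ)
    (hc : ∀ j, c j = Nat.card (M ⧸ (towerIdeal p j • ⊤ : Submodule (IwasawaAlgebra p) M)))
    {m k : ℕ} (hlt : c (m + k) < p ^ k * c m) (hpt : ∀ x : M, (p : IwasawaAlgebra p) • x = 0 → x = 0)
    {i : ℕ} (hi : m + k ≤ i) : c i = p ^ lambdaInvariant p M := by
  have h := finite_modP_and_natCard_eq_of_lt p c hc hlt
  have hT := isTorsion_and_mu_eq_zero_of_finite_modP p h.1
  have hmod : modPSubmodule p M = Ideal.span {(p : IwasawaAlgebra p)} • ⊤ := by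
    rw [modPSubmodule, map_natCast]
  rw [h.2 i hi, hmod]
  exact SignedTransportAtTwo.natCard_quotient_eq_pow_lambdaInvariant p M hT.1 hT.2 hpt

/-- **EXACT `λ` from two layer counts when `X` has no nonzero finite `Λ`-submodule** (the shape of Greenberg LNM 1716 Props.
4.14/4.15 for Selmer duals): `c (m+k) < p^k · c m` ⇒ `c i = p^{λ(X)}` for every `i ≥ m+k` (cell-`b2b` Route-G
`Additive.card_quotient_eq_pow_lambdaInvariant_holds`). So two generalised descents with sub-maximal growth give `μ = 0` AND `λ`
on the nose. [cite: Washington1997, §13.2] [cite: GreenbergLNM1716, Props. 4.14–4.15 (shape only)] -/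
theorem natCard_layer_eq_pow_lambdaInvariant_of_lt_of_noFinite (c : ℕ → ℕ)
    (hc : ∀ j, c j = Nat.card (M ⧸ (towerIdeal p j • ⊤ : Submodule (IwasawaAlgebra p) M)))
    {m k : ℕ} (hlt : c (m + k) < p ^ k * c m) (hnf : ∀ N : Submodule (IwasawaAlgebra p) M, Finite N → N = ⊥)
    {i : ℕ} (hi : m + k ≤ i) : c i = p ^ lambdaInvariant p M := by
  have h := finite_modP_and_natCard_eq_of_lt p c hc hlt
  have hT := isTorsion_and_mu_eq_zero_of_finite_modP p h.1
  rw [h.2 i hi]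
  exact Summit.BirchSwinnertonDyer.Rank1Residual.Additive.card_quotient_eq_pow_lambdaInvariant_holds p M hT.1 hT.2 hnf

/-! ### Layers `n ↦ p^n`: the counts `L n = #(X/(p, ω_n)X) = c (p^n)` -/

omit [Module.Finite (IwasawaAlgebra p) M] in
/-- `X/(p, ω_n)X` and `X/(p, T^{p^n})X` are the same quotient (`(p, ω_n) = (p, T^{p^n})`). [folklore] -/
theorem natCard_quotient_omega_eq (n : ℕ) :
    Nat.card (M ⧸ ((Ideal.span {(PowerSeries.C (p : ℤ_[p]) : IwasawaAlgebra p)} ⊔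
        Ideal.span {omega p n}) • ⊤ : Submodule (IwasawaAlgebra p) M)) =
      Nat.card (M ⧸ (towerIdeal p (p ^ n) • ⊤ : Submodule (IwasawaAlgebra p) M)) := by
  rw [span_C_p_sup_span_omega_eq_towerIdeal]

/-- **Log-concavity across layers**: `L (n+2) · L n ^ p ≤ L (n+1) ^ (p+1)` for `L n = c (p^n)` — in `𝔽_p`-dimensions
`d_{n+2} − d_{n+1} ≤ p · (d_{n+1} − d_n)`: the growth per layer at most multiplies by `p` (at `p = 2`: at most doubles).
(Three-term log-concavity at `a = p^n, b = p^{n+1}, d = p^{n+2}`, after extracting a `p^n (p−1)`-th root.) [folklore] -/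
theorem natCard_layer_pow_logConcave (c : ℕ → ℕ)
    (hc : ∀ j, c j = Nat.card (M ⧸ (towerIdeal p j • ⊤ : Submodule (IwasawaAlgebra p) M))) (n : ℕ) :
    c (p ^ (n + 2)) * c (p ^ n) ^ p ≤ c (p ^ (n + 1)) ^ (p + 1) := by
  have hp1 : 1 ≤ p := hp.out.one_lt.le
  have hpos : ∀ j, 0 < c j := fun j => (hc j).symm ▸ natCard_layer_pos p j
  have hlc : ∀ j, c (j + 2) * c j ≤ c (j + 1) ^ 2 := fun j => by
    rw [hc, hc, hc]; exact natCard_layer_logConcave p j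
  -- step 1: `p^{n+1} − p^n = p^n (p-1)` late steps vs the block `[p^n, p^{n+1})`
  set a := p ^ n with ha
  set b := p ^ (n + 1) with hb
  set d := p ^ (n + 2) with hd
  have hab : a ≤ b := Nat.pow_le_pow_right hp1 (Nat.le_succ n)
  have hbd : b ≤ d := Nat.pow_le_pow_right hp1 (Nat.le_succ (n + 1))
  have hba : b - a = p ^ n * (p - 1) := by
    rw [hb, ha, pow_succ, Nat.mul_sub, mul_one]
  have hdb : d - b = p ^ n * (p - 1) * p := by
    rw [hd, hb, pow_succ, pow_succ, Nat.mul_sub, mul_one]; ring_nf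
    rw [Nat.mul_sub]; ring_nf
  have hda : d - a = p ^ n * (p - 1) * (p + 1) := by
    have : d - a = (d - b) + (b - a) := by omega
    rw [this, hdb, hba]; ring
  have h3 := pow_mul_pow_le_pow_of_logConcave hpos hlc hab hbd
  rw [hdb, hba, hda] at h3
  -- h3 : c a ^ (e * p) * c d ^ e ≤ c b ^ (e * (p+1)) with e = p^n (p-1) > 0; take e-th roots
  set e := p ^ n * (p - 1) with he
  have hepos : 0 < e := Nat.mul_pos (Nat.pow_pos hp.out.pos) (by have := hp.out.two_le; omega)
  have h4 : (c d * c a ^ p) ^ e ≤ (c b ^ (p + 1)) ^ e := by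
    calc (c d * c a ^ p) ^ e = c a ^ (e * p) * c d ^ e := by ring
      _ ≤ c b ^ (e * (p + 1)) := h3
      _ = (c b ^ (p + 1)) ^ e := by ring
  exact (Nat.pow_le_pow_iff_left hepos.ne').mp h4

/-- **Freezing across layers**: sub-maximal growth between layers `n` and `n+1`, `L (n+1) < p^{p^{n+1} − p^n} · L n`, makes
`X/pX` finite and the counts STATIONARY from layer `n+1` on: `L n' = #(X/pX)` for every `n' ≥ n+1` (indeed `c i = #(X/pX)`
for every `i ≥ p^{n+1}`). [folklore] -/
theorem finite_modP_and_natCard_layer_eq_of_lt (c : ℕ → ℕ)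
    (hc : ∀ j, c j = Nat.card (M ⧸ (towerIdeal p j • ⊤ : Submodule (IwasawaAlgebra p) M))) {n : ℕ}
    (hlt : c (p ^ (n + 1)) < p ^ (p ^ (n + 1) - p ^ n) * c (p ^ n)) :
    Finite (M ⧸ modPSubmodule p M) ∧
      ∀ n', n + 1 ≤ n' → c (p ^ n') = Nat.card (M ⧸ modPSubmodule p M) := by
  have hp1 : 1 ≤ p := hp.out.one_lt.le
  have hle : p ^ n ≤ p ^ (n + 1) := Nat.pow_le_pow_right hp1 (Nat.le_succ n)
  have hlt' : c (p ^ n + (p ^ (n + 1) - p ^ n)) < p ^ (p ^ (n + 1) - p ^ n) * c (p ^ n) := by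
    rwa [Nat.add_sub_cancel' hle]
  have h := finite_modP_and_natCard_eq_of_lt p c hc hlt'
  refine ⟨h.1, fun n' hn' => h.2 _ ?_⟩
  rw [Nat.add_sub_cancel' hle]
  exact Nat.pow_le_pow_right hp1 hn'

/-- **The layer certificate, complete reading.** Sub-maximal growth between layers `n` and `n+1` of the counts
`L n = #(X/(p, ω_n)X)` certifies at once: `X` is `Λ`-torsion with `μ(X) = 0`; `#(X/pX) = L (n+1)`; `L n' = L (n+1)` for all
`n' ≥ n+1`; and `p^{λ(X)} ≤ L (n+1)`. (At `p = 2` in `𝔽₂`-dimensions: `d_{n+1} − d_n < 2^n ⇒ μ = 0`, `d_{n'} = d_{n+1}` for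
`n' > n`, `λ ≤ d_{n+1}`.) [cite: Washington1997, §13.2] [cite: Fukuda1994, Thm. 1] -/
theorem layer_certificate_of_lt (c : ℕ → ℕ)
    (hc : ∀ j, c j = Nat.card (M ⧸ (towerIdeal p j • ⊤ : Submodule (IwasawaAlgebra p) M))) {n : ℕ}
    (hlt : c (p ^ (n + 1)) < p ^ (p ^ (n + 1) - p ^ n) * c (p ^ n)) :
    (Module.IsTorsion (IwasawaAlgebra p) M ∧ muInvariant p M = 0) ∧
      Nat.card (M ⧸ modPSubmodule p M) = c (p ^ (n + 1)) ∧
      (∀ n', n + 1 ≤ n' → c (p ^ n') = c (p ^ (n + 1))) ∧ p ^ lambdaInvariant p M ≤ c (p ^ (n + 1)) := by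
  have hp1 : 1 ≤ p := hp.out.one_lt.le
  have hle : p ^ n ≤ p ^ (n + 1) := Nat.pow_le_pow_right hp1 (Nat.le_succ n)
  have hlt' : c (p ^ n + (p ^ (n + 1) - p ^ n)) < p ^ (p ^ (n + 1) - p ^ n) * c (p ^ n) := by
    rwa [Nat.add_sub_cancel' hle]
  have h := certificate_of_lt p c hc hlt'
  rw [Nat.add_sub_cancel' hle] at h
  refine ⟨h.1, h.2.1, fun n' hn' => h.2.2.1 _ (Nat.pow_le_pow_right hp1 hn'), h.2.2.2⟩

end Consumers

/-! ## §5 The same in the Kobayashi currency of a signed Selmer dual datum (any `p`, any sign) -/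

section Kobayashi

open Kobayashi2003

universe u

variable {p : ℕ} [hp : Fact p.Prime] {K : Type u} [Field K] [NumberField K] {W : WeierstrassCurve K}
  {κ : ZpExtension K p} {γ : Field.absoluteGaloisGroup K} {ε : ℤˣ}

/-- **Layer certificate for `X^ε(E/K_∞)`.** For a signed Selmer dual datum `D` with `X = D.X` finitely generated over `Λ`
and its layer counts `L n = #(X/(p, ω_n)X)`: sub-maximal growth between layers `n` and `n+1` ⇒ `X` torsion, `μ^ε = 0`,
the counts stationary from layer `n+1` on at the value `#(X/pX)`, and `p^{λ^ε} ≤ L (n+1)`. Nothing about any curve is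
asserted: the counts are hypotheses. [cite: Kobayashi2003, Thm. 1.4 (the invariants only)] [cite: Washington1997, §13.2] -/
theorem signedSelmerDual_layer_certificate_of_lt (D : SignedSelmerDualData W κ γ ε)
    [Module.Finite (IwasawaAlgebra p) D.X] (c : ℕ → ℕ)
    (hc : ∀ j, c j = Nat.card (D.X ⧸ (towerIdeal p j • ⊤ : Submodule (IwasawaAlgebra p) D.X))) {n : ℕ}
    (hlt : c (p ^ (n + 1)) < p ^ (p ^ (n + 1) - p ^ n) * c (p ^ n)) :
    (Module.IsTorsion (IwasawaAlgebra p) D.X ∧ D.mu = 0) ∧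
      Nat.card (D.X ⧸ modPSubmodule p D.X) = c (p ^ (n + 1)) ∧
      (∀ n', n + 1 ≤ n' → c (p ^ n') = c (p ^ (n + 1))) ∧ p ^ D.lambda ≤ c (p ^ (n + 1)) :=
  layer_certificate_of_lt p c hc hlt

end Kobayashi

end Summit.BirchSwinnertonDyer.BirchSwinnertonDyer.Theorems.SignedMuAtTwo.TowerStaircase
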